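import Summits.HodgeConjecture.HodgeConjecture.Theorems.TropicalWeilObstructionTropicalWeilVanishingClassPositivityChecker
import Summits.HodgeConjecture.HodgeConjecture.Theorems.TropicalWeilObstructionTropicalHodgeBoundCertificateClasses

/-!
# Crux `TropicalWeilVanishing` (K1 of route `TropicalWeilObstruction`, stmt-HodgeConjecture-18478):
# the class-positivity certificate `κ = 8` — part 4, SOUNDNESS of the checker and bridges to K3's classes

Route `HodgeConjecture/TropicalWeilObstruction` is a REFUTATION route (Kontsevich's tropical test, negative
branch); this file is negation-sink bookkeeping of the cell `pub-hodge-tropical` (seat tropical-1) and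
decides nothing about the Hodge conjecture, in either direction, and nothing about the OPEN crux K1
(`TropicalWeilVanishing`, stmt-HodgeConjecture-18478).

From passed checks (hypotheses here; discharged by the kernel runs of `…ClassPositivityCertRun` in
`…ClassPositivityCone`) to the identity of bi-alternating INTEGER tables on ALL pairs of words
`I, J : Fin 4 → Fin 8`:

  `Σ_{t<206} n_t · p_{L_t}(I) · p_{L_t}(J) = 24 · (8 · θ̃(I, J) + Re w̃(I, J))`
  (`sum_frameSquares_eq_classes`),

with `p_L = pluckerCoord L` (`Literature/AlgebraicGeometry/Tropical/TorusCycles`) and K3's integer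
coordinates `Chk.thetaZ` (`θ̃ = det 1[I,J]`, i.e. `θ₄(1)`) and `Chk.wG` (`w̃(I,J) = det Ω[I,·] det Ω[J,·]`,
i.e. `w(1)`). Steps: soundness of the list recursions (`checkSatL_sound`, `colL_sound`, `checkColsL_sound`,
`checkSparseL_sound`, `rowS_sound`, `checkGramS_sound`), fibrewise resummation of a sparse column
(`sparse_resum`), the identity at increasing word pairs in terms of the frames (`gram_frames`), decided
bridges from the word codes to K3's `Chk.wordOfRank` / `Chk.sortedWords` (`wd_wordCode`, `wl_wordCode`),
`plkD = pluckerCoord ∘ frameOf` (`Chk.det4R_eq_det`), `targetD = 24 (8 θ̃ + Re w̃)` (`Chk.theta_bridge`,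
`Chk.omegaMinorN_eq`), and the extension from increasing pairs to all pairs for bi-alternating tables
(`eq_of_eq_on_words`, K3's `Chk.y_eq_transport` / `Chk.y_eq_zero_of_eq`; `pluckerCoord` is alternating by
`Matrix.det_permute`, the classes by `Chk.classes_perm_left/right`). Also: every listed frame is
saturated (`invOf_mul_frameOf`). No definition, no sorry.

## References
* [Zharkov2020TropicalWeil] I. Zharkov, Tropical abelian varieties, Weil classes and the Hodge conjecture,
  arXiv:2002.02347, §2 (pp. 2–4).
* [MikhalkinZharkov2014Eigenwave] G. Mikhalkin, I. Zharkov, Tropical eigenwave and intermediate Jacobians,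
  Prop. 4.3.
* [BlekhermanSmithVelasco2016] G. Blekherman, G. G. Smith, M. Velasco, Sums of squares and varieties of
  minimal degree, J. Amer. Math. Soc. 29 (2016), Thm. 1.1.
-/

set_option linter.dupNamespace false

namespace Summit.HodgeConjecture.HodgeConjecture.Theorems.TropicalWeilVanishing

namespace Kappa
open scoped BigOperators
open Matrix
open Literature.AlgebraicGeometry.Tropical
open Summit.HodgeConjecture.HodgeConjecture.Theorems.TropicalHodgeBound
/-! ### Lengths of the data lists -/

/-- `wordCode` has `70` entries. [folklore] -/
theorem length_wordCode : wordCode.length = 70 := rfl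

set_option maxRecDepth 4096 in
/-- `frameCode` has `206` entries. [folklore] -/
theorem length_frameCode : frameCode.length = 206 := rfl

set_option maxRecDepth 4096 in
/-- `invCode` has `206` entries. [folklore] -/
theorem length_invCode : invCode.length = 206 := rfl

/-- `colCode` has `70` entries. [folklore] -/
theorem length_colCode : colCode.length = 70 := rfl

/-- `colSparse` has `70` entries. [folklore] -/
theorem length_colSparse : colSparse.length = 70 := rfl

/-! ### Soundness of the list checkers -/

/-- Soundness of `checkSatL`. [folklore] -/
theorem checkSatL_sound : ∀ (ms fs : List ℕ), checkSatL ms fs = true → ∀ t, t < ms.length →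
    t < fs.length → ∀ a b : Fin 4, satEntry (ms.getD t 0) (fs.getD t 0) a b = if a = b then 1 else 0
  | [], _, _, t, ht, _ => by simp at ht
  | _ :: _, [], _, t, _, ht => by simp at ht
  | m :: ms, f :: fs, h, t, hm, hf => by
      simp only [checkSatL, Bool.and_eq_true, decide_eq_true_eq] at h
      cases t with
      | zero => simpa using h.1
      | succ t =>
          simp only [List.getD_cons_succ]
          exact checkSatL_sound ms fs h.2 t (by simpa using hm) (by simpa using hf)

/-- Soundness of `colL`. [folklore] -/
theorem colL_sound : ∀ (w c : ℕ) (fs : List ℕ) (k : ℕ), colL w c fs k = true →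
    ∀ t, t < fs.length → cdig c (k + t) = plkD (fs.getD t 0) w
  | _, _, [], _, _, t, ht => by simp at ht
  | w, c, f :: fs, k, h, t, ht => by
      simp only [colL, Bool.and_eq_true, decide_eq_true_eq] at h
      cases t with
      | zero => simpa using h.1
      | succ t =>
          have := colL_sound w c fs (k + 1) h.2 t (by simpa using ht)
          simpa [Nat.add_assoc, Nat.add_comm 1 t] using this

/-- Soundness of `checkColsL`. [folklore] -/
theorem checkColsL_sound : ∀ (n : ℕ) (ws cs : List ℕ), checkColsL n ws cs = true →
    ∀ r, r < n → r < ws.length → r < cs.length → colL (ws.getD r 0) (cs.getD r 0) frameCode 0 = true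
  | 0, _, _, _, r, hr, _, _ => by omega
  | _ + 1, [], _, _, r, _, hr, _ => by simp at hr
  | _ + 1, _ :: _, [], _, r, _, _, hr => by simp at hr
  | n + 1, w :: ws, c :: cs, h, r, hn, hw, hc => by
      simp only [checkColsL, Bool.and_eq_true] at h
      cases r with
      | zero => simpa using h.1
      | succ r =>
          simp only [List.getD_cons_succ]
          exact checkColsL_sound n ws cs h.2 r (by omega) (by simpa using hw) (by simpa using hc)

/-- A passed column chunk gives the Plücker columns of ranks `lo ≤ r < lo + n`. [folklore] -/
theorem col_of_checkCols {lo n : ℕ} (h : checkCols lo n = true) (r : ℕ) (h1 : lo ≤ r) (h2 : r < lo + n)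
    (hr : r < 70) (t : ℕ) (ht : t < 206) :
    cdig (colCode.getD r 0) t = plkD (frameCode.getD t 0) (wordCode.getD r 0) := by
  have hs := checkColsL_sound n _ _ h (r - lo) (by omega)
    (by simp [length_wordCode]; omega) (by simp [length_colCode]; omega)
  have gd : ∀ (l : List ℕ) (i j : ℕ), (l.drop i).getD j 0 = l.getD (i + j) 0 := fun l i j => by
    simp [List.getD_eq_getElem?_getD, List.getElem?_drop]
  rw [gd, gd, show lo + (r - lo) = r by omega] at hs
  have := colL_sound _ _ frameCode 0 hs t (by simpa [length_frameCode] using ht)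
  simpa using this

/-- Soundness of `sparseOne`. [folklore] -/
theorem sparseOne_sound {c : ℕ} {l : List ℕ} (h : sparseOne c l = true) :
    (∀ e ∈ l, e / 2 < 206) ∧ ∀ t, t < 206 → cdig c t = lookupS l t := by
  simp only [sparseOne, Bool.and_eq_true, List.all_eq_true, decide_eq_true_eq, List.mem_range] at h
  exact ⟨h.1, h.2⟩

/-- Soundness of `checkSparseL`. [folklore] -/
theorem checkSparseL_sound : ∀ (cs : List ℕ) (ls : List (List ℕ)), checkSparseL cs ls = true →
    ∀ r, r < cs.length → r < ls.length → sparseOne (cs.getD r 0) (ls.getD r []) = true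
  | [], _, _, r, hr, _ => by simp at hr
  | _ :: _, [], _, r, _, hr => by simp at hr
  | c :: cs, l :: ls, h, r, hc, hl => by
      simp only [checkSparseL, Bool.and_eq_true] at h
      cases r with
      | zero => simpa using h.1
      | succ r =>
          simp only [List.getD_cons_succ]
          exact checkSparseL_sound cs ls h.2 r (by simpa using hc) (by simpa using hl)

/-- `gramS` is the list sum of its terms. [folklore] -/
theorem gramS_eq (c' : ℕ) : ∀ l : List ℕ,
    gramS c' l = (l.map fun e => (wt (e / 2) : ℤ) * cdig c' (e / 2) * sgE e).sum
  | [] => rfl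
  | e :: es => by rw [gramS, gramS_eq c' es, List.map_cons, List.sum_cons]; ring

/-- Fibrewise resummation of a sparse column over the positions `t < 206`. [folklore] -/
theorem sparse_resum (F : ℕ → ℤ) : ∀ l : List ℕ, (∀ e ∈ l, e / 2 < 206) →
    (l.map fun e => F (e / 2) * sgE e).sum = ∑ t ∈ Finset.range 206, F t * lookupS l t
  | [], _ => by simp [lookupS]
  | e :: es, h => by
      have he : e / 2 < 206 := h e (by simp)
      have hes : ∀ e' ∈ es, e' / 2 < 206 := fun e' he' => h e' (by simp [he'])
      rw [List.map_cons, List.sum_cons, sparse_resum F es hes]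
      have hsplit : ∀ t, F t * lookupS (e :: es) t =
          F t * (if e / 2 = t then sgE e else 0) + F t * lookupS es t := by
        intro t; simp only [lookupS, List.map_cons, List.sum_cons]; ring
      simp only [hsplit, Finset.sum_add_distrib]
      congr 1
      rw [Finset.sum_eq_single (e / 2)]
      · simp
      · intro t _ ht; simp [Ne.symm ht]
      · intro h'; exact absurd (Finset.mem_range.mpr he) h'

/-- Soundness of `rowS`. [folklore] -/
theorem rowS_sound : ∀ (w : ℕ) (l : List ℕ) (ws cs : List ℕ), rowS w l ws cs = true →
    ∀ b, b < ws.length → b < cs.length → gramS (cs.getD b 0) l = targetD w (ws.getD b 0)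
  | _, _, [], _, _, b, hb, _ => by simp at hb
  | _, _, _ :: _, [], _, b, _, hb => by simp at hb
  | w, l, w' :: ws, c' :: cs, h, b, hw, hc => by
      simp only [rowS, Bool.and_eq_true, decide_eq_true_eq] at h
      cases b with
      | zero => simpa using h.1
      | succ b =>
          simp only [List.getD_cons_succ]
          exact rowS_sound w l ws cs h.2 b (by simpa using hw) (by simpa using hc)

/-- Soundness of `checkGramS`: all pairs `a ≤ b` with `a < n`. [folklore] -/
theorem checkGramS_sound : ∀ (n : ℕ) (ws : List ℕ) (ls : List (List ℕ)) (cs : List ℕ),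
    checkGramS n ws ls cs = true → ∀ a b, a < n → a ≤ b → b < ws.length → b < cs.length →
      a < ls.length → gramS (cs.getD b 0) (ls.getD a []) = targetD (ws.getD a 0) (ws.getD b 0)
  | 0, _, _, _, _, a, b, ha, _, _, _, _ => by omega
  | _ + 1, [], _, _, _, a, b, _, _, hb, _, _ => by simp at hb
  | _ + 1, _ :: _, [], _, _, a, b, _, _, _, _, ha => by simp at ha
  | _ + 1, _ :: _, _ :: _, [], _, a, b, _, _, _, hb, _ => by simp at hb
  | n + 1, w :: ws, l :: ls, c :: cs, h, a, b, hn, hab, hw, hc, hl => by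
      simp only [checkGramS, Bool.and_eq_true] at h
      cases a with
      | zero =>
          simp only [List.getD_cons_zero]
          exact rowS_sound w l (w :: ws) (c :: cs) h.1 b hw hc
      | succ a =>
          cases b with
          | zero => omega
          | succ b =>
              simp only [List.getD_cons_succ]
              exact checkGramS_sound n ws ls cs h.2 a b (by omega) (by omega) (by simpa using hw)
                (by simpa using hc) (by simpa using hl)

/-! ### The Gram identity on increasing word pairs, in terms of the frames -/

/-- `targetD` is symmetric. [folklore] -/
theorem targetD_comm (w w' : ℕ) : targetD w w' = targetD w' w := by
  unfold targetD Chk.basisN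
  simp only [mul_comm (Chk.omegaMinorN (wl w)) (Chk.omegaMinorN (wl w')), eq_comm (a := wl w)]

/-- **The certified identity at increasing word pairs** (`i, j < 70`):
`Σ_{t<206} n_t · p_t(w_i) · p_t(w_j) = 24 · (8 θ₄(1) + Re w(1))(w_i, w_j)`, from the kernel runs.
[folklore] -/
theorem gram_frames (hsat : checkSparse = true) (hgram : checkGram 0 70 = true)
    (hcol : ∀ r, r < 70 → ∀ t, t < 206 →
      cdig (colCode.getD r 0) t = plkD (frameCode.getD t 0) (wordCode.getD r 0))
    (i j : ℕ) (hi : i < 70) (hj : j < 70) :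
    ∑ t ∈ Finset.range 206, (wt t : ℤ) * plkD (frameCode.getD t 0) (wordCode.getD i 0) *
        plkD (frameCode.getD t 0) (wordCode.getD j 0) = targetD (wordCode.getD i 0) (wordCode.getD j 0) := by
  -- without loss of generality `i ≤ j`
  wlog hij : i ≤ j generalizing i j
  · rw [targetD_comm, ← this j i hj hi (by omega)]
    exact Finset.sum_congr rfl fun t _ => by ring
  -- the sparse row `i`
  obtain ⟨hrange, hdig⟩ := sparseOne_sound (checkSparseL_sound _ _ hsat i
    (by simp [length_colCode, hi]) (by simp [length_colSparse, hi]))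
  have hg := checkGramS_sound 70 _ _ _ hgram i j hi hij (by simp [length_wordCode, hj])
    (by simp [length_colCode, hj]) (by simp [length_colSparse, hi])
  simp only [List.drop_zero] at hg
  rw [← hg, gramS_eq]
  have hF := sparse_resum (fun t => (wt t : ℤ) * cdig (colCode.getD j 0) t) (colSparse.getD i [])
    hrange
  rw [hF]
  refine Finset.sum_congr rfl fun t ht => ?_
  rw [Finset.mem_range] at ht
  rw [← hdig t ht, hcol i hi t ht, hcol j hj t ht]
  ring

/-! ### Bridges to K3's words and classes -/

/-- The word codes are K3's increasing words (digits). [folklore] -/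
theorem wd_wordCode : ∀ r : Fin 70, ∀ a : Fin 4,
    Chk.wd (wordCode.getD r 0) a = (Chk.wordOfRank r a : ℕ) := by
  decide +kernel

/-- The word codes are K3's increasing words (digit lists). [folklore] -/
theorem wl_wordCode : ∀ r : Fin 70, wl (wordCode.getD r 0) = Chk.sortedWords.getD r [] := by
  decide +kernel

/-- `plkD` is the Plücker coordinate of `frameOf` at K3's word. [folklore] -/
theorem plkD_eq_pluckerCoord (f : ℕ) (r : Fin 70) :
    plkD f (wordCode.getD r 0) = pluckerCoord (frameOf f) (Chk.wordOfRank r) := by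
  unfold plkD pluckerCoord
  rw [Chk.det4R_eq_det]
  congr 1
  ext a b
  rw [Matrix.of_apply, wd_wordCode r a]
  rfl

/-- `targetD` at K3's words is `24 · (8 θ̃ + Re w̃)`. [cite: Zharkov2020TropicalWeil, §2] -/
theorem targetD_eq (i j : Fin 70) : targetD (wordCode.getD i 0) (wordCode.getD j 0) =
    24 * (8 * Chk.thetaZ (Chk.wordOfRank i) (Chk.wordOfRank j) +
      (Chk.wG (Chk.wordOfRank i) (Chk.wordOfRank j)).re) := by
  unfold targetD
  rw [wl_wordCode i, wl_wordCode j, Chk.theta_bridge i j]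
  unfold Chk.basisN Chk.wG
  simp only
  rw [Chk.omegaMinorN_eq i, Chk.omegaMinorN_eq j]

/-! ### From increasing word pairs to all word pairs -/

/-- Two bi-alternating integer tables that agree on increasing word pairs agree everywhere
(K3's transport `Chk.y_eq_transport`, vanishing `Chk.y_eq_zero_of_eq`). [folklore] -/
theorem eq_of_eq_on_words (y F : (Fin 4 → Fin (2 * 4)) → (Fin 4 → Fin (2 * 4)) → ℤ)
    (hyI : ∀ (c d : Fin 4 → Fin (2 * 4)) (τ : Equiv.Perm (Fin 4)),
      y (c ∘ τ) d = ((Equiv.Perm.sign τ : ℤˣ) : ℤ) * y c d)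
    (hyJ : ∀ (c d : Fin 4 → Fin (2 * 4)) (τ : Equiv.Perm (Fin 4)),
      y c (d ∘ τ) = ((Equiv.Perm.sign τ : ℤˣ) : ℤ) * y c d)
    (hFI : ∀ (c d : Fin 4 → Fin (2 * 4)) (τ : Equiv.Perm (Fin 4)),
      F (c ∘ τ) d = ((Equiv.Perm.sign τ : ℤˣ) : ℤ) * F c d)
    (hFJ : ∀ (c d : Fin 4 → Fin (2 * 4)) (τ : Equiv.Perm (Fin 4)),
      F c (d ∘ τ) = ((Equiv.Perm.sign τ : ℤˣ) : ℤ) * F c d)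
    (h : ∀ i j : Fin 70, y (Chk.wordOfRank i) (Chk.wordOfRank j) = F (Chk.wordOfRank i) (Chk.wordOfRank j))
    (I J : Fin 4 → Fin (2 * 4)) : y I J = F I J := by
  have hc : ∀ a : Fin 4, Chk.fn4 (I 0 : ℕ) (I 1 : ℕ) (I 2 : ℕ) (I 3 : ℕ) a = (I a : ℕ) := by
    intro a; fin_cases a <;> rfl
  have hd : ∀ a : Fin 4, Chk.fn4 (J 0 : ℕ) (J 1 : ℕ) (J 2 : ℕ) (J 3 : ℕ) a = (J a : ℕ) := by
    intro a; fin_cases a <;> rfl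
  have hc0 : Chk.fn4 (I 0 : ℕ) (I 1 : ℕ) (I 2 : ℕ) (I 3 : ℕ) 0 = (I 0 : ℕ) := hc 0
  have hc1 : Chk.fn4 (I 0 : ℕ) (I 1 : ℕ) (I 2 : ℕ) (I 3 : ℕ) 1 = (I 1 : ℕ) := hc 1
  have hc2 : Chk.fn4 (I 0 : ℕ) (I 1 : ℕ) (I 2 : ℕ) (I 3 : ℕ) 2 = (I 2 : ℕ) := hc 2
  have hc3 : Chk.fn4 (I 0 : ℕ) (I 1 : ℕ) (I 2 : ℕ) (I 3 : ℕ) 3 = (I 3 : ℕ) := hc 3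
  have hd0 : Chk.fn4 (J 0 : ℕ) (J 1 : ℕ) (J 2 : ℕ) (J 3 : ℕ) 0 = (J 0 : ℕ) := hd 0
  have hd1 : Chk.fn4 (J 0 : ℕ) (J 1 : ℕ) (J 2 : ℕ) (J 3 : ℕ) 1 = (J 1 : ℕ) := hd 1
  have hd2 : Chk.fn4 (J 0 : ℕ) (J 1 : ℕ) (J 2 : ℕ) (J 3 : ℕ) 2 = (J 2 : ℕ) := hd 2
  have hd3 : Chk.fn4 (J 0 : ℕ) (J 1 : ℕ) (J 2 : ℕ) (J 3 : ℕ) 3 = (J 3 : ℕ) := hd 3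
  by_cases hci : Chk.inj4 (Chk.fn4 (I 0 : ℕ) (I 1 : ℕ) (I 2 : ℕ) (I 3 : ℕ)) = true
  · by_cases hdi : Chk.inj4 (Chk.fn4 (J 0 : ℕ) (J 1 : ℕ) (J 2 : ℕ) (J 3 : ℕ)) = true
    · rw [Chk.y_eq_transport y hyI hyJ I J _ _ hc hd hci hdi,
        Chk.y_eq_transport F hFI hFJ I J _ _ hc hd hci hdi]
      congr 1
      -- the unknown code is in range: both sorted ranks are `< 70`
      have hci' : I 0 ≠ I 1 ∧ I 0 ≠ I 2 ∧ I 0 ≠ I 3 ∧ I 1 ≠ I 2 ∧ I 1 ≠ I 3 ∧ I 2 ≠ I 3 := by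
        unfold Chk.inj4 at hci; rw [decide_eq_true_eq] at hci
        rw [hc0, hc1, hc2, hc3] at hci
        refine ⟨?_, ?_, ?_, ?_, ?_, ?_⟩ <;> intro h' <;> simp_all
      have hdi' : J 0 ≠ J 1 ∧ J 0 ≠ J 2 ∧ J 0 ≠ J 3 ∧ J 1 ≠ J 2 ∧ J 1 ≠ J 3 ∧ J 2 ≠ J 3 := by
        unfold Chk.inj4 at hdi; rw [decide_eq_true_eq] at hdi
        rw [hd0, hd1, hd2, hd3] at hdi
        refine ⟨?_, ?_, ?_, ?_, ?_, ?_⟩ <;> intro h' <;> simp_all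
      obtain ⟨-, -, hrI⟩ := Chk.sort_bridge (I 0) (I 1) (I 2) (I 3) hci'
      obtain ⟨-, -, hrJ⟩ := Chk.sort_bridge (J 0) (J 1) (J 2) (J 3) hdi'
      have hsI : Chk.sortedL (Chk.fn4 (I 0 : ℕ) (I 1 : ℕ) (I 2 : ℕ) (I 3 : ℕ)) =
          Chk.sort4 (I 0) (I 1) (I 2) (I 3) := by
        unfold Chk.sortedL; rw [hc0, hc1, hc2, hc3]
      have hsJ : Chk.sortedL (Chk.fn4 (J 0 : ℕ) (J 1 : ℕ) (J 2 : ℕ) (J 3 : ℕ)) =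
          Chk.sort4 (J 0) (J 1) (J 2) (J 3) := by
        unfold Chk.sortedL; rw [hd0, hd1, hd2, hd3]
      unfold Chk.yvOf Chk.unkN
      rw [hsI, hsJ]
      have h1 : (70 * Chk.rankL (Chk.sort4 (I 0 : ℕ) (I 1) (I 2) (I 3)) +
          Chk.rankL (Chk.sort4 (J 0 : ℕ) (J 1) (J 2) (J 3))) / 70 =
          Chk.rankL (Chk.sort4 (I 0 : ℕ) (I 1) (I 2) (I 3)) := by omega
      have h2 : (70 * Chk.rankL (Chk.sort4 (I 0 : ℕ) (I 1) (I 2) (I 3)) +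
          Chk.rankL (Chk.sort4 (J 0 : ℕ) (J 1) (J 2) (J 3))) % 70 =
          Chk.rankL (Chk.sort4 (J 0 : ℕ) (J 1) (J 2) (J 3)) := by omega
      rw [h1, h2]
      exact h ⟨_, hrI⟩ ⟨_, hrJ⟩
    · obtain ⟨i, j, hij, hij'⟩ := Chk.exists_eq_of_inj4 J _ hd hdi
      have e1 : y I J = 0 := by
        have := Chk.y_eq_zero_of_eq (fun d' c' => y c' d') (fun d' c' τ => hyJ c' d' τ) J I i j hij hij'
        simpa using this
      have e2 : F I J = 0 := by
        have := Chk.y_eq_zero_of_eq (fun d' c' => F c' d') (fun d' c' τ => hFJ c' d' τ) J I i j hij hij'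
        simpa using this
      rw [e1, e2]
  · obtain ⟨i, j, hij, hij'⟩ := Chk.exists_eq_of_inj4 I _ hc hci
    rw [Chk.y_eq_zero_of_eq y hyI I J i j hij hij', Chk.y_eq_zero_of_eq F hFI I J i j hij hij']

/-- The Plücker coordinate is alternating in the word. [folklore] -/
theorem pluckerCoord_comp_perm (L : Matrix (Fin (2 * 4)) (Fin 4) ℤ) (S : Fin 4 → Fin (2 * 4))
    (τ : Equiv.Perm (Fin 4)) :
    pluckerCoord L (S ∘ τ) = ((Equiv.Perm.sign τ : ℤˣ) : ℤ) * pluckerCoord L S := by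
  unfold pluckerCoord
  rw [show L.submatrix (S ∘ τ) id = (L.submatrix S id).submatrix τ id from rfl, Matrix.det_permute]
  simp

/-- **The certificate as an identity of bi-alternating integer tables on ALL word pairs:**
`Σ_{t<206} n_t p_{L_t}(I) p_{L_t}(J) = 24 (8 θ̃(I,J) + Re w̃(I,J))` with K3's integer classes
`Chk.thetaZ`, `Chk.wG` (the coordinates of `θ₄(1)` and `w(1)`). [folklore] -/
theorem sum_frameSquares_eq_classes (hsat : checkSparse = true) (hgram : checkGram 0 70 = true)
    (hcol : ∀ r, r < 70 → ∀ t, t < 206 →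
      cdig (colCode.getD r 0) t = plkD (frameCode.getD t 0) (wordCode.getD r 0))
    (I J : Fin 4 → Fin (2 * 4)) :
    ∑ t ∈ Finset.range 206, (wt t : ℤ) * pluckerCoord (frameOf (frameCode.getD t 0)) I *
        pluckerCoord (frameOf (frameCode.getD t 0)) J =
      24 * (8 * Chk.thetaZ I J + (Chk.wG I J).re) := by
  refine eq_of_eq_on_words
    (fun I J => ∑ t ∈ Finset.range 206, (wt t : ℤ) * pluckerCoord (frameOf (frameCode.getD t 0)) I *
      pluckerCoord (frameOf (frameCode.getD t 0)) J)
    (fun I J => 24 * (8 * Chk.thetaZ I J + (Chk.wG I J).re)) ?_ ?_ ?_ ?_ ?_ I J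
  · intro c d τ
    simp only [pluckerCoord_comp_perm, Finset.mul_sum]
    exact Finset.sum_congr rfl fun t _ => by ring
  · intro c d τ
    simp only [pluckerCoord_comp_perm, Finset.mul_sum]
    exact Finset.sum_congr rfl fun t _ => by ring
  · intro c d τ
    have := Chk.classes_perm_left 192 (-24) 0 c d τ
    simp only [zero_mul, sub_zero] at this
    linear_combination this
  · intro c d τ
    have := Chk.classes_perm_right 192 (-24) 0 c d τ
    simp only [zero_mul, sub_zero] at this
    linear_combination this
  · intro i j
    simp only [← plkD_eq_pluckerCoord, ← targetD_eq]
    exact gram_frames hsat hgram hcol i j i.isLt j.isLt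

/-! ### Saturation and positivity -/

/-- `satEntry` is the entry of the matrix product. [folklore] -/
theorem satEntry_eq (m f : ℕ) (a b : Fin 4) : satEntry m f a b = (invOf m * frameOf f) a b := by
  rw [Matrix.mul_apply, Fin.sum_univ_eight]
  rfl

/-- Every listed frame is saturated: `M_t L_t = 1`. [folklore] -/
theorem invOf_mul_frameOf (hsat : checkSat = true) (t : ℕ) (ht : t < 206) :
    invOf (invCode.getD t 0) * frameOf (frameCode.getD t 0) = 1 := by
  ext a b
  rw [← satEntry_eq, Matrix.one_apply]
  exact checkSatL_sound _ _ hsat t (by simp [length_invCode, ht]) (by simp [length_frameCode, ht]) a b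

end Kappa

end Summit.HodgeConjecture.HodgeConjecture.Theorems.TropicalWeilVanishing
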